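import Literature.NumberTheory.Automorphic.ArchEndoscopicChartMeasures    -- ★ p849670 (T-MEAS): `endoTorusHom`, `chartTorusH`, `chartBox(Img)`, `chartHaarH`, `chartQuotientMeasureH`, `chartOrbH`
import Mathlib.Analysis.SpecialFunctions.Complex.Log
import HarnessLib

/-!
# The chart torus `T_S ≤ H_∞` IS the range of the chart: the per-place characterisation and closedness
# (the first THEOREMS file behind PACK-SPEC (δ3): Rogawski 1990 §3.6, §8.2; Shelstad 1979 §4)

Topic `NumberTheory/Automorphic`; namespace `Literature.NumberTheory.Automorphic.UnitaryGroup`.  THEOREMS ONLY (no `def`, no instance, no notation, no axiom, no named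
fact, no `sorry`).  Cell `pub/hodgecm-mathlib`, crux H413 (`stmt-HodgeConjecture-24833`), F0∕P3c line LH3 (closer stub `stub_N9`, DIRECT ROAD); the sibling of ★
p849670 `ArchEndoscopicChartMeasures` ((T-MEAS), LH2-p04 (g3)) carrying the first of the load-bearing proofs LH3-plan (g2)'s ruling (δ3) (2026-09-02T05:52:31Z) asks for («the one real proof»: the range of the chart is
closed); the box positivity and the Haar-freeness of `chartOrbH` are the sibling `ArchEndoscopicChartOrbFree`.

* §1 **`exists_endoTorus_eq_iff`** — THE RANGE OF THE CHART, PLACE BY PLACE: `h ∈ H_∞` is a chart point `endoTorus S c` iff at every split place `w ∈ S` its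
  `U(Φ₂)_w`-block is DIAGONAL and at every compact place `w ∉ S` it has CAYLEY shape `(p q; q p)` (the `U(Φ₁)`-component is free).  ⇐ reads the coordinates off
  the entries (`x = log|a|`, `θ = arg a`; `c₀ = arg(p+q)`, `c₂ = arg(p−q)`; `φ = arg u`), unitarity supplying `a ≠ 0`, `d = ā⁻¹`, `|p ± q| = 1`, `|u| = 1`.  Hence
  **`isClosed_range_endoTorusHom`**, **`chartTorusH_eq_range`** (the closure in ★ `chartTorusH` changed nothing), `mem_chartTorusH_iff`.
HONEST LABEL: HC_CM is proved only modulo the 7 printed citations (2 remaining: hLiu418 = `stmt-HodgeConjecture-24832`, h413 = `stmt-HodgeConjecture-24833`) until rung 0 closes;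
count-neutral.

## References
* [Rogawski1990] J. D. Rogawski, *Automorphic Representations of Unitary Groups in Three Variables*, Ann. of Math. Stud. 123 (1990), §3.6 p. 31 (Cartan subgroups of `U(1,1)`,
  `U(2,1)`), §8.2 p. 122 (the compact Cartan in Cayley coordinates), §4.9 p. 54.
* [Shelstad1979] D. Shelstad, *Characters and inner forms of a quasi-split group over ℝ*, Compositio Math. 39 (1979), §4 p. 22 (`T`, `dt`).
* [Folland1995] G. B. Folland, *A Course in Abstract Harmonic Analysis* (1995), §2.2, §2.6 Thm. 2.49.
-/

set_option autoImplicit false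

noncomputable section

open NumberField NumberField.InfinitePlace Matrix Complex Topology
open Literature.MeasureTheory.Group
open scoped MatrixGroups Matrix ComplexConjugate Classical

namespace Literature.NumberTheory.Automorphic.UnitaryGroup

open Literature.NumberTheory.Rogawski1990

/-! ### Matrix lemmas: the `Φ₂`-unitarity equations for the two chart shapes -/

section MatrixLemmas

/-- Entry `(0,1)` of `M̄ᵀ Φ₂ M = Φ₂` for a DIAGONAL `M`: `conj (M 0 0) * M 1 1 = 1`. [folklore] -/
private theorem conj_mul_eq_one_of_diag_unitary {M : Matrix (Fin 2) (Fin 2) ℂ}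
    (h : (M.map (starRingEnd ℂ))ᵀ * (Matrix.of fun i j : Fin 2 => if i.val + j.val + 1 = 2 then (1 : ℂ) else 0) * M =
      (Matrix.of fun i j : Fin 2 => if i.val + j.val + 1 = 2 then (1 : ℂ) else 0))
    (h10 : M 1 0 = 0) : conj (M 0 0) * M 1 1 = 1 := by
  have e := congrFun (congrFun h 0) 1
  simp [Matrix.mul_apply, Fin.sum_univ_two, h10] at e
  exact e

/-- For a `Φ₂`-unitary `M` of CAYLEY shape (`M 0 0 = M 1 1 = p`, `M 0 1 = M 1 0 = q`): `|p + q| = 1` and `|p − q| = 1`. [folklore] -/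
private theorem norm_add_eq_one_and_norm_sub_eq_one_of_cayley_unitary {M : Matrix (Fin 2) (Fin 2) ℂ}
    (h : (M.map (starRingEnd ℂ))ᵀ * (Matrix.of fun i j : Fin 2 => if i.val + j.val + 1 = 2 then (1 : ℂ) else 0) * M =
      (Matrix.of fun i j : Fin 2 => if i.val + j.val + 1 = 2 then (1 : ℂ) else 0))
    (hd : M 0 0 = M 1 1) (ho : M 0 1 = M 1 0) : ‖M 0 0 + M 0 1‖ = 1 ∧ ‖M 0 0 - M 0 1‖ = 1 := by
  have e01 := congrFun (congrFun h 0) 1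
  have e00 := congrFun (congrFun h 0) 0
  simp [Matrix.mul_apply, Fin.sum_univ_two, ← hd, ← ho] at e01 e00
  -- e01 : conj p * p + conj q * q = 1 (up to order) ; e00 : conj p * q + conj q * p = 0
  have hsq1 : (‖M 0 0 + M 0 1‖ : ℂ) ^ 2 = 1 := by
    rw [← Complex.conj_mul', map_add]
    linear_combination e01 + e00
  have hsq2 : (‖M 0 0 - M 0 1‖ : ℂ) ^ 2 = 1 := by
    rw [← Complex.conj_mul', map_sub]
    linear_combination e01 - e00
  have h1 : ‖M 0 0 + M 0 1‖ ^ 2 = 1 := by exact_mod_cast hsq1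
  have h2 : ‖M 0 0 - M 0 1‖ ^ 2 = 1 := by exact_mod_cast hsq2
  exact ⟨by nlinarith [norm_nonneg (M 0 0 + M 0 1)], by nlinarith [norm_nonneg (M 0 0 - M 0 1)]⟩

/-- Entry of `(z̄) (1) (z) = (1)` at `N = 1`: `|z| = 1`. [folklore] -/
private theorem norm_eq_one_of_unitary_one {M : Matrix (Fin 1) (Fin 1) ℂ}
    (h : (M.map (starRingEnd ℂ))ᵀ * (Matrix.diagonal fun _ : Fin 1 => (1 : ℂ)) * M = Matrix.diagonal fun _ : Fin 1 => (1 : ℂ)) : ‖M 0 0‖ = 1 := by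
  have e := congrFun (congrFun h 0) 0
  simp [Matrix.mul_apply] at e
  have hsq : (‖M 0 0‖ : ℂ) ^ 2 = 1 := by rw [← Complex.conj_mul']; exact e
  have h1 : ‖M 0 0‖ ^ 2 = 1 := by exact_mod_cast hsq
  nlinarith [norm_nonneg (M 0 0)]

/-- A unit complex number is `e^{i arg}`: `exp (arg z * I) = z` when `‖z‖ = 1`. [folklore] -/
private theorem exp_arg_mul_I_of_norm_eq_one {z : ℂ} (hz : ‖z‖ = 1) : Complex.exp ((arg z : ℂ) * I) = z := by
  have h := Complex.norm_mul_exp_arg_mul_I z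
  rwa [hz, Complex.ofReal_one, one_mul] at h

/-- `exp (log ‖a‖ + i arg a) = a` for `a ≠ 0` (the complex logarithm). [folklore] -/
private theorem exp_log_norm_add_arg {a : ℂ} (ha : a ≠ 0) : Complex.exp ((Real.log ‖a‖ : ℂ) + (arg a : ℂ) * I) = a :=
  Complex.exp_log ha

/-- `exp (−log ‖a‖ + i arg a) = (conj a)⁻¹` for `a ≠ 0`. [folklore] -/
private theorem exp_neg_log_norm_add_arg {a : ℂ} (ha : a ≠ 0) : Complex.exp (-(Real.log ‖a‖ : ℂ) + (arg a : ℂ) * I) = (conj a)⁻¹ := by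
  have h1 := conj_exp_mul_exp_eq_one (Real.log ‖a‖) (arg a)
  rw [exp_log_norm_add_arg ha] at h1
  exact (eq_inv_of_mul_eq_one_right h1)

end MatrixLemmas

/-! ### §1 The per-place characterisation of the range of the chart -/

section Range

variable (L : Type) [Field L] [NumberField L] [IsCMField L] (S : Finset {w : InfinitePlace L // IsComplex w})

/-- (→) SPLIT place: the `2`-block of a chart point is diagonal. [cite: Rogawski1990, §3.6 p. 31] -/
theorem archPiEquivCM_endoTorus_fst_apply_eq_zero_of_mem (c : {w : InfinitePlace L // IsComplex w} → Fin 3 → ℝ)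
    {w : {w : InfinitePlace L // IsComplex w}} (hw : w ∈ S) :
    (((archPiEquivCM 2 L (Matrix.of fun i j : Fin 2 => if i.val + j.val + 1 = 2 then (1 : L) else 0) (endoTorus L S c).1 w :
        ↥(archLocal L 2 (Matrix.of fun i j : Fin 2 => if i.val + j.val + 1 = 2 then (1 : L) else 0) w)) : GL (Fin 2) ℂ) : Matrix (Fin 2) (Fin 2) ℂ) 0 1 = 0 ∧
    (((archPiEquivCM 2 L (Matrix.of fun i j : Fin 2 => if i.val + j.val + 1 = 2 then (1 : L) else 0) (endoTorus L S c).1 w :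
        ↥(archLocal L 2 (Matrix.of fun i j : Fin 2 => if i.val + j.val + 1 = 2 then (1 : L) else 0) w)) : GL (Fin 2) ℂ) : Matrix (Fin 2) (Fin 2) ℂ) 1 0 = 0 := by
  rw [archPiEquivCM_endoTorus_fst, coe_endoBlock_of_mem L c hw]
  simp

/-- (→) COMPACT place: the `2`-block of a chart point has Cayley shape `(p q; q p)`. [cite: Rogawski1990, §8.2 p. 122] -/
theorem archPiEquivCM_endoTorus_fst_apply_eq_of_not_mem (c : {w : InfinitePlace L // IsComplex w} → Fin 3 → ℝ)
    {w : {w : InfinitePlace L // IsComplex w}} (hw : w ∉ S) :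
    (((archPiEquivCM 2 L (Matrix.of fun i j : Fin 2 => if i.val + j.val + 1 = 2 then (1 : L) else 0) (endoTorus L S c).1 w :
        ↥(archLocal L 2 (Matrix.of fun i j : Fin 2 => if i.val + j.val + 1 = 2 then (1 : L) else 0) w)) : GL (Fin 2) ℂ) : Matrix (Fin 2) (Fin 2) ℂ) 0 0 =
      (((archPiEquivCM 2 L (Matrix.of fun i j : Fin 2 => if i.val + j.val + 1 = 2 then (1 : L) else 0) (endoTorus L S c).1 w :
        ↥(archLocal L 2 (Matrix.of fun i j : Fin 2 => if i.val + j.val + 1 = 2 then (1 : L) else 0) w)) : GL (Fin 2) ℂ) : Matrix (Fin 2) (Fin 2) ℂ) 1 1 ∧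
    (((archPiEquivCM 2 L (Matrix.of fun i j : Fin 2 => if i.val + j.val + 1 = 2 then (1 : L) else 0) (endoTorus L S c).1 w :
        ↥(archLocal L 2 (Matrix.of fun i j : Fin 2 => if i.val + j.val + 1 = 2 then (1 : L) else 0) w)) : GL (Fin 2) ℂ) : Matrix (Fin 2) (Fin 2) ℂ) 0 1 =
      (((archPiEquivCM 2 L (Matrix.of fun i j : Fin 2 => if i.val + j.val + 1 = 2 then (1 : L) else 0) (endoTorus L S c).1 w :
        ↥(archLocal L 2 (Matrix.of fun i j : Fin 2 => if i.val + j.val + 1 = 2 then (1 : L) else 0) w)) : GL (Fin 2) ℂ) : Matrix (Fin 2) (Fin 2) ℂ) 1 0 := by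
  rw [archPiEquivCM_endoTorus_fst, coe_endoBlock_of_not_mem L c hw]
  simp

/-- **THE RANGE OF THE CHART, PLACE BY PLACE.**  `h ∈ H_∞` is a chart point `endoTorus S c` iff at every split place `w ∈ S` its `U(Φ₂)_w`-block is DIAGONAL and at
every compact place `w ∉ S` it has CAYLEY shape `(p q; q p)` (= `P·diag·P⁻¹`); the `U(Φ₁)`-component is unconstrained.  (⇐: `x_w = log|a|`, `θ_w = arg a` at split
places — unitarity forces the diagonal block to be `diag(a, ā⁻¹)`; `c_w0 = arg(p+q)`, `c_w2 = arg(p−q)` at compact places — unitarity forces `|p ± q| = 1`; `φ_w = arg`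
of the `U(1)`-entry.) [cite: Rogawski1990, §3.6 p. 31; §8.2 p. 122] [cite: Shelstad1979, §4 p. 22] -/
theorem exists_endoTorus_eq_iff
    (h : ↥(arch (↥(maximalRealSubfield L)) L (IsCMField.complexConj L) 2 (Matrix.of fun i j : Fin 2 => if i.val + j.val + 1 = 2 then (1 : L) else 0)) ×
      ↥(arch (↥(maximalRealSubfield L)) L (IsCMField.complexConj L) 1 (Matrix.of fun i j : Fin 1 => if i.val + j.val + 1 = 1 then (1 : L) else 0))) :
    (∃ c, endoTorus L S c = h) ↔
      ∀ w : {w : InfinitePlace L // IsComplex w},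
        (w ∈ S →
          (((archPiEquivCM 2 L (Matrix.of fun i j : Fin 2 => if i.val + j.val + 1 = 2 then (1 : L) else 0) h.1 w :
              ↥(archLocal L 2 (Matrix.of fun i j : Fin 2 => if i.val + j.val + 1 = 2 then (1 : L) else 0) w)) : GL (Fin 2) ℂ) : Matrix (Fin 2) (Fin 2) ℂ) 0 1 = 0 ∧
          (((archPiEquivCM 2 L (Matrix.of fun i j : Fin 2 => if i.val + j.val + 1 = 2 then (1 : L) else 0) h.1 w :
              ↥(archLocal L 2 (Matrix.of fun i j : Fin 2 => if i.val + j.val + 1 = 2 then (1 : L) else 0) w)) : GL (Fin 2) ℂ) : Matrix (Fin 2) (Fin 2) ℂ) 1 0 = 0) ∧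
        (w ∉ S →
          (((archPiEquivCM 2 L (Matrix.of fun i j : Fin 2 => if i.val + j.val + 1 = 2 then (1 : L) else 0) h.1 w :
              ↥(archLocal L 2 (Matrix.of fun i j : Fin 2 => if i.val + j.val + 1 = 2 then (1 : L) else 0) w)) : GL (Fin 2) ℂ) : Matrix (Fin 2) (Fin 2) ℂ) 0 0 =
            (((archPiEquivCM 2 L (Matrix.of fun i j : Fin 2 => if i.val + j.val + 1 = 2 then (1 : L) else 0) h.1 w :
              ↥(archLocal L 2 (Matrix.of fun i j : Fin 2 => if i.val + j.val + 1 = 2 then (1 : L) else 0) w)) : GL (Fin 2) ℂ) : Matrix (Fin 2) (Fin 2) ℂ) 1 1 ∧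
          (((archPiEquivCM 2 L (Matrix.of fun i j : Fin 2 => if i.val + j.val + 1 = 2 then (1 : L) else 0) h.1 w :
              ↥(archLocal L 2 (Matrix.of fun i j : Fin 2 => if i.val + j.val + 1 = 2 then (1 : L) else 0) w)) : GL (Fin 2) ℂ) : Matrix (Fin 2) (Fin 2) ℂ) 0 1 =
            (((archPiEquivCM 2 L (Matrix.of fun i j : Fin 2 => if i.val + j.val + 1 = 2 then (1 : L) else 0) h.1 w :
              ↥(archLocal L 2 (Matrix.of fun i j : Fin 2 => if i.val + j.val + 1 = 2 then (1 : L) else 0) w)) : GL (Fin 2) ℂ) : Matrix (Fin 2) (Fin 2) ℂ) 1 0) := by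
  constructor
  · rintro ⟨c, rfl⟩ w
    exact ⟨fun hw => archPiEquivCM_endoTorus_fst_apply_eq_zero_of_mem L S c hw,
      fun hw => archPiEquivCM_endoTorus_fst_apply_eq_of_not_mem L S c hw⟩
  · intro hshape
    -- abbreviations: the place-component maps
    set E₂ := archPiEquivCM 2 L (Matrix.of fun i j : Fin 2 => if i.val + j.val + 1 = 2 then (1 : L) else 0) with hE₂
    set E₁ := archPiEquivCM 1 L (Matrix.of fun i j : Fin 1 => if i.val + j.val + 1 = 1 then (1 : L) else 0) with hE₁
    -- unitarity of the components
    have hU₂ : ∀ w, ((((E₂ h.1 w : ↥(archLocal L 2 _ w)) : GL (Fin 2) ℂ) : Matrix (Fin 2) (Fin 2) ℂ).map (starRingEnd ℂ))ᵀ *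
        (Matrix.of fun i j : Fin 2 => if i.val + j.val + 1 = 2 then (1 : ℂ) else 0) * (((E₂ h.1 w : ↥(archLocal L 2 _ w)) : GL (Fin 2) ℂ) : Matrix (Fin 2) (Fin 2) ℂ) =
        (Matrix.of fun i j : Fin 2 => if i.val + j.val + 1 = 2 then (1 : ℂ) else 0) := fun w => by
      have hm := (E₂ h.1 w).2
      rw [mem_archLocal_iff, Literature.NumberTheory.Rogawski1990.antidiagOne_map (w.1.embedding) 2] at hm
      exact hm
    have hU₁ : ∀ w, ((((E₁ h.2 w : ↥(archLocal L 1 _ w)) : GL (Fin 1) ℂ) : Matrix (Fin 1) (Fin 1) ℂ).map (starRingEnd ℂ))ᵀ *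
        (Matrix.diagonal fun _ : Fin 1 => (1 : ℂ)) * (((E₁ h.2 w : ↥(archLocal L 1 _ w)) : GL (Fin 1) ℂ) : Matrix (Fin 1) (Fin 1) ℂ) =
        Matrix.diagonal fun _ : Fin 1 => (1 : ℂ) := fun w => by
      have hm := (E₁ h.2 w).2
      rw [mem_archLocal_iff, antidiagOne_map L (w.1.embedding)] at hm
      exact hm
    -- the coordinates, read off the components
    refine ⟨fun w i =>
      if w ∈ S then
        (if i = 0 then Real.log ‖(((E₂ h.1 w : ↥(archLocal L 2 _ w)) : GL (Fin 2) ℂ) : Matrix (Fin 2) (Fin 2) ℂ) 0 0‖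
         else if i = 2 then arg ((((E₂ h.1 w : ↥(archLocal L 2 _ w)) : GL (Fin 2) ℂ) : Matrix (Fin 2) (Fin 2) ℂ) 0 0)
         else arg ((((E₁ h.2 w : ↥(archLocal L 1 _ w)) : GL (Fin 1) ℂ) : Matrix (Fin 1) (Fin 1) ℂ) 0 0))
      else
        (if i = 0 then arg ((((E₂ h.1 w : ↥(archLocal L 2 _ w)) : GL (Fin 2) ℂ) : Matrix (Fin 2) (Fin 2) ℂ) 0 0 +
            (((E₂ h.1 w : ↥(archLocal L 2 _ w)) : GL (Fin 2) ℂ) : Matrix (Fin 2) (Fin 2) ℂ) 0 1)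
         else if i = 2 then arg ((((E₂ h.1 w : ↥(archLocal L 2 _ w)) : GL (Fin 2) ℂ) : Matrix (Fin 2) (Fin 2) ℂ) 0 0 -
            (((E₂ h.1 w : ↥(archLocal L 2 _ w)) : GL (Fin 2) ℂ) : Matrix (Fin 2) (Fin 2) ℂ) 0 1)
         else arg ((((E₁ h.2 w : ↥(archLocal L 1 _ w)) : GL (Fin 1) ℂ) : Matrix (Fin 1) (Fin 1) ℂ) 0 0)), ?_⟩
    refine Prod.ext ?_ ?_
    · -- the `U(Φ₂)` component, place by place
      apply E₂.injective
      funext w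
      rw [archPiEquivCM_endoTorus_fst]
      apply Subtype.ext
      apply Units.ext
      by_cases hw : w ∈ S
      · -- split place: the block is `diag(a, ā⁻¹)`, `a ≠ 0`
        obtain ⟨h01, h10⟩ := (hshape w).1 hw
        have hdet := conj_mul_eq_one_of_diag_unitary (hU₂ w) h10
        have ha : (((E₂ h.1 w : ↥(archLocal L 2 _ w)) : GL (Fin 2) ℂ) : Matrix (Fin 2) (Fin 2) ℂ) 0 0 ≠ 0 := by
          intro h0
          rw [h0, map_zero, zero_mul] at hdet
          exact zero_ne_one hdet
        have hd : (((E₂ h.1 w : ↥(archLocal L 2 _ w)) : GL (Fin 2) ℂ) : Matrix (Fin 2) (Fin 2) ℂ) 1 1 =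
            (conj ((((E₂ h.1 w : ↥(archLocal L 2 _ w)) : GL (Fin 2) ℂ) : Matrix (Fin 2) (Fin 2) ℂ) 0 0))⁻¹ :=
          eq_inv_of_mul_eq_one_right hdet
        rw [coe_endoBlock_of_mem L _ hw]
        simp only [if_pos hw, if_true, show (2 : Fin 3) ≠ 0 from by decide, if_false]
        rw [exp_log_norm_add_arg ha, exp_neg_log_norm_add_arg ha,
          Matrix.eta_fin_two (((E₂ h.1 w : ↥(archLocal L 2 _ w)) : GL (Fin 2) ℂ) : Matrix (Fin 2) (Fin 2) ℂ)]
        simp only [h01, h10, hd]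
        simp
      · -- compact place: the block is `P diag(u, v) P⁻¹`, `u = p + q`, `v = p − q`, `|u| = |v| = 1`
        obtain ⟨hdiag, hoff⟩ := (hshape w).2 hw
        obtain ⟨hu, hv⟩ := norm_add_eq_one_and_norm_sub_eq_one_of_cayley_unitary (hU₂ w) hdiag hoff
        rw [coe_endoBlock_of_not_mem L _ hw]
        simp only [if_neg hw, if_true, show (2 : Fin 3) ≠ 0 from by decide, if_false]
        rw [Circle.coe_exp, Circle.coe_exp, exp_arg_mul_I_of_norm_eq_one hu, exp_arg_mul_I_of_norm_eq_one hv,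
          Matrix.eta_fin_two (((E₂ h.1 w : ↥(archLocal L 2 _ w)) : GL (Fin 2) ℂ) : Matrix (Fin 2) (Fin 2) ℂ)]
        simp only [← hdiag, ← hoff]
        ext i j
        fin_cases i <;> fin_cases j <;> simp
    · -- the `U(Φ₁)` component: `e^{i arg z} = z`
      apply E₁.injective
      funext w
      rw [archPiEquivCM_endoTorus_snd]
      apply Subtype.ext
      apply Units.ext
      have hz := norm_eq_one_of_unitary_one (hU₁ w)
      rw [coe_endoCircle]
      have h1 : ¬ ((1 : Fin 3) = 0) := by decide
      have h2 : ¬ ((1 : Fin 3) = 2) := by decide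
      simp only [h1, h2, if_false, ite_self]
      rw [Circle.coe_exp, exp_arg_mul_I_of_norm_eq_one hz]
      ext i j
      fin_cases i; fin_cases j
      simp

end Range

/-! ### The range is closed; `chartTorusH = range` -/

section Closed

variable (L : Type) [Field L] [NumberField L] [IsCMField L] (S : Finset {w : InfinitePlace L // IsComplex w})

/-- The `(i, j)` entry of the `U(Φ₂)_w`-component depends continuously on `h ∈ H_∞`. [cite: Rogawski1990, §3.6 p. 31] -/
theorem continuous_archPiEquivCM_fst_apply (w : {w : InfinitePlace L // IsComplex w}) (i j : Fin 2) :
    Continuous fun h : ↥(arch (↥(maximalRealSubfield L)) L (IsCMField.complexConj L) 2 (Matrix.of fun i j : Fin 2 => if i.val + j.val + 1 = 2 then (1 : L) else 0)) ×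
        ↥(arch (↥(maximalRealSubfield L)) L (IsCMField.complexConj L) 1 (Matrix.of fun i j : Fin 1 => if i.val + j.val + 1 = 1 then (1 : L) else 0)) =>
      (((archPiEquivCM 2 L (Matrix.of fun i j : Fin 2 => if i.val + j.val + 1 = 2 then (1 : L) else 0) h.1 w :
          ↥(archLocal L 2 (Matrix.of fun i j : Fin 2 => if i.val + j.val + 1 = 2 then (1 : L) else 0) w)) : GL (Fin 2) ℂ) : Matrix (Fin 2) (Fin 2) ℂ) i j :=
  ((Units.continuous_val.comp (continuous_subtype_val.comp ((continuous_apply w).comp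
    ((archPiEquivCM 2 L _).continuous.comp continuous_fst)))).matrix_elem i j)

/-- **THE SET OF CHART POINTS IS CLOSED IN `H_∞`** (the shape conditions of `exists_endoTorus_eq_iff` are closed equations in the entries).
[cite: Shelstad1979, §4 p. 22] [cite: Rogawski1990, §3.6 p. 31] -/
theorem isClosed_setOf_exists_endoTorus_eq :
    IsClosed {h : ↥(arch (↥(maximalRealSubfield L)) L (IsCMField.complexConj L) 2 (Matrix.of fun i j : Fin 2 => if i.val + j.val + 1 = 2 then (1 : L) else 0)) ×
        ↥(arch (↥(maximalRealSubfield L)) L (IsCMField.complexConj L) 1 (Matrix.of fun i j : Fin 1 => if i.val + j.val + 1 = 1 then (1 : L) else 0)) |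
      ∃ c, endoTorus L S c = h} := by
  have hset : {h : ↥(arch (↥(maximalRealSubfield L)) L (IsCMField.complexConj L) 2 (Matrix.of fun i j : Fin 2 => if i.val + j.val + 1 = 2 then (1 : L) else 0)) ×
        ↥(arch (↥(maximalRealSubfield L)) L (IsCMField.complexConj L) 1 (Matrix.of fun i j : Fin 1 => if i.val + j.val + 1 = 1 then (1 : L) else 0)) |
      ∃ c, endoTorus L S c = h} = ⋂ w : {w : InfinitePlace L // IsComplex w}, {h |
        (w ∈ S →
          (((archPiEquivCM 2 L (Matrix.of fun i j : Fin 2 => if i.val + j.val + 1 = 2 then (1 : L) else 0) h.1 w :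
              ↥(archLocal L 2 (Matrix.of fun i j : Fin 2 => if i.val + j.val + 1 = 2 then (1 : L) else 0) w)) : GL (Fin 2) ℂ) : Matrix (Fin 2) (Fin 2) ℂ) 0 1 = 0 ∧
          (((archPiEquivCM 2 L (Matrix.of fun i j : Fin 2 => if i.val + j.val + 1 = 2 then (1 : L) else 0) h.1 w :
              ↥(archLocal L 2 (Matrix.of fun i j : Fin 2 => if i.val + j.val + 1 = 2 then (1 : L) else 0) w)) : GL (Fin 2) ℂ) : Matrix (Fin 2) (Fin 2) ℂ) 1 0 = 0) ∧
        (w ∉ S →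
          (((archPiEquivCM 2 L (Matrix.of fun i j : Fin 2 => if i.val + j.val + 1 = 2 then (1 : L) else 0) h.1 w :
              ↥(archLocal L 2 (Matrix.of fun i j : Fin 2 => if i.val + j.val + 1 = 2 then (1 : L) else 0) w)) : GL (Fin 2) ℂ) : Matrix (Fin 2) (Fin 2) ℂ) 0 0 =
            (((archPiEquivCM 2 L (Matrix.of fun i j : Fin 2 => if i.val + j.val + 1 = 2 then (1 : L) else 0) h.1 w :
              ↥(archLocal L 2 (Matrix.of fun i j : Fin 2 => if i.val + j.val + 1 = 2 then (1 : L) else 0) w)) : GL (Fin 2) ℂ) : Matrix (Fin 2) (Fin 2) ℂ) 1 1 ∧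
          (((archPiEquivCM 2 L (Matrix.of fun i j : Fin 2 => if i.val + j.val + 1 = 2 then (1 : L) else 0) h.1 w :
              ↥(archLocal L 2 (Matrix.of fun i j : Fin 2 => if i.val + j.val + 1 = 2 then (1 : L) else 0) w)) : GL (Fin 2) ℂ) : Matrix (Fin 2) (Fin 2) ℂ) 0 1 =
            (((archPiEquivCM 2 L (Matrix.of fun i j : Fin 2 => if i.val + j.val + 1 = 2 then (1 : L) else 0) h.1 w :
              ↥(archLocal L 2 (Matrix.of fun i j : Fin 2 => if i.val + j.val + 1 = 2 then (1 : L) else 0) w)) : GL (Fin 2) ℂ) : Matrix (Fin 2) (Fin 2) ℂ) 1 0)} := by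
    ext h
    rw [Set.mem_setOf_eq, exists_endoTorus_eq_iff, Set.mem_iInter]
    rfl
  rw [hset]
  refine isClosed_iInter fun w => ?_
  by_cases hw : w ∈ S
  · have h' := (isClosed_eq (continuous_archPiEquivCM_fst_apply L w 0 1) (continuous_const (y := (0 : ℂ)))).inter
      (isClosed_eq (continuous_archPiEquivCM_fst_apply L w 1 0) (continuous_const (y := (0 : ℂ))))
    convert h' using 1
    ext h
    simp [hw, Set.mem_inter_iff]
  · have h' := (isClosed_eq (continuous_archPiEquivCM_fst_apply L w 0 0) (continuous_archPiEquivCM_fst_apply L w 1 1)).inter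
      (isClosed_eq (continuous_archPiEquivCM_fst_apply L w 0 1) (continuous_archPiEquivCM_fst_apply L w 1 0))
    convert h' using 1
    ext h
    simp [hw, Set.mem_inter_iff]

/-- Membership in the range of ★ `endoTorusHom` is «being a chart point». [cite: Rogawski1990, §3.6 p. 31] -/
theorem mem_range_endoTorusHom_iff
    (h : ↥(arch (↥(maximalRealSubfield L)) L (IsCMField.complexConj L) 2 (Matrix.of fun i j : Fin 2 => if i.val + j.val + 1 = 2 then (1 : L) else 0)) ×
      ↥(arch (↥(maximalRealSubfield L)) L (IsCMField.complexConj L) 1 (Matrix.of fun i j : Fin 1 => if i.val + j.val + 1 = 1 then (1 : L) else 0))) :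
    h ∈ (endoTorusHom L S).range ↔ ∃ c, endoTorus L S c = h :=
  ⟨fun ⟨a, ha⟩ => ⟨Multiplicative.toAdd a, ha⟩, fun ⟨c, hc⟩ => ⟨Multiplicative.ofAdd c, hc⟩⟩

/-- **THE RANGE OF THE CHART IS CLOSED** (a Cartan subgroup). [cite: Shelstad1979, §4 p. 22] [cite: Rogawski1990, §3.6 p. 31] -/
theorem isClosed_range_endoTorusHom :
    IsClosed ((endoTorusHom L S).range : Set (↥(arch (↥(maximalRealSubfield L)) L (IsCMField.complexConj L) 2 (Matrix.of fun i j : Fin 2 => if i.val + j.val + 1 = 2 then (1 : L) else 0)) ×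
      ↥(arch (↥(maximalRealSubfield L)) L (IsCMField.complexConj L) 1 (Matrix.of fun i j : Fin 1 => if i.val + j.val + 1 = 1 then (1 : L) else 0)))) := by
  have hset : ((endoTorusHom L S).range : Set _) = {h | ∃ c, endoTorus L S c = h} := by
    ext h
    exact mem_range_endoTorusHom_iff L S h
  rw [hset]
  exact isClosed_setOf_exists_endoTorus_eq L S

/-- **★ `chartTorusH S` IS THE RANGE OF THE CHART** (the topological closure in its definition changed nothing). [cite: Shelstad1979, §4 p. 22] [cite: Rogawski1990, §3.6 p. 31] -/
theorem chartTorusH_eq_range : chartTorusH L S = (endoTorusHom L S).range :=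
  le_antisymm (Subgroup.topologicalClosure_minimal _ le_rfl (isClosed_range_endoTorusHom L S)) (range_endoTorusHom_le_chartTorusH L S)

/-- **Every element of `T_S` is a chart point.** [cite: Rogawski1990, §3.6 p. 31; §8.2 p. 122] -/
theorem mem_chartTorusH_iff
    (h : ↥(arch (↥(maximalRealSubfield L)) L (IsCMField.complexConj L) 2 (Matrix.of fun i j : Fin 2 => if i.val + j.val + 1 = 2 then (1 : L) else 0)) ×
      ↥(arch (↥(maximalRealSubfield L)) L (IsCMField.complexConj L) 1 (Matrix.of fun i j : Fin 1 => if i.val + j.val + 1 = 1 then (1 : L) else 0))) :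
    h ∈ chartTorusH L S ↔ ∃ c, endoTorus L S c = h := by
  rw [chartTorusH_eq_range]
  exact mem_range_endoTorusHom_iff L S h

end Closed


end Literature.NumberTheory.Automorphic.UnitaryGroup

end
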